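import Summits.BirchSwinnertonDyer.BirchSwinnertonDyer.Theorems.PrintCf2RamifiedOffTYZCasselsTatePinJumpOne
import Summits.BirchSwinnertonDyer.BirchSwinnertonDyer.Theorems.PrintCf2RamifiedOffTYZCasselsTateAdjugatePin
import Literature.NumberTheory.EllipticCurves.Smith2016.CongruentNumberBSDSelmerRankTwo
import HarnessLib

/-!
# The ADJUGATE PIN on the jump-one class of `E_n` (crux stmt-BirchSwinnertonDyer-20509 `RamifiedOffTYZOfFacts`, line `offtyz-v7`,
# LEAD cruxlead-20509 g22, cycle 23) — pieces (E)×(S) of the idea `cassels-tate-entries` (item 23431) IN COORDINATES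

HONEST FRAMING (cell `bsd-print-cf2`, route `PrintCf2`; `--supports stmt-BirchSwinnertonDyer-20509`; `def`-free, no `sorry`; the
Cassels–Tate form is an explicit ARGUMENT `C` with its (U4) kernel shape, as in g21's `CasselsTatePin*`; the packaged §3 takes GZK
(conjunct 1 of `𝔅_ram`) and the CT fact `casselsTate_pairing_levelKernel ℚ` as hypotheses, like g21's `exists_pinned_form_on_jumpOne_class`).
BSD is not proved by any of this; no class is closed; 20509 / 23431 / 23432 stay OPEN.

WHAT. On the jump-one class (square-free `n`, `rank E_n(ℚ) = 1`, `#Sel₂(E_n) = 2⁵`, `#Sel₄(E_n) = 2⁶` — the hypotheses of C⁺ =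
`PrintCf2.RamifiedJumpOneLevelTwoOfFacts`), for ANY alternating `C` on `Sel₂(E_n)` with left kernel `[2]_* Sel₄(E_n)` (values with
collinear `2`-torsion, e.g. `ℚ/ℤ`) and ANY three Selmer classes `s₁ s₂ s₃` generating `Sel₂(E_n)` over the torsion classes
`κ₂(E_n(ℚ)[2])`, with entries `c_ij = ⟨sᵢ, sⱼ⟩` and adjugate vector `v = [c₂₃ ≠ 0]s₁ + [c₁₃ ≠ 0]s₂ + [c₁₂ ≠ 0]s₃`:

* §2 `natCard_selmerGroup_four_eq_two_pow_eight_iff_entries` — on category D of rank one, **`#Sel₄(E_n) = 2⁸ ⟺ c₁₂ = c₁₃ = c₂₃ = 0`**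
  (the census B-label is the conjunction of THREE entries); `entries_ne_zero_of_selmerFour` — on the jump-one class some entry is `≠ 0`;
  `exists_kummer_eq_adjugate_of_selmerFour` — some rational point has `κ₂(P) = v`.
* §3 (statements with point arithmetic, classical `DecidableEq` as in the generic Kummer lemmas):
  ★ `kummer_eq_or_eq_add_adjugate_of_selmerFour` — **every rational point has `κ₂(P) ≡ 0` or `≡ v` modulo a torsion class**;
  ★★ `exists_odd_point_kummer_eq_adjugate_of_selmerFour` — **a rational point `P ∉ E_n(ℚ)[2] + 2E_n(ℚ)` (an odd multiple of the
  Mordell–Weil generator up to torsion) has `κ₂(P) = v`**: the three Cassels–Tate entries NAME the generator's `2`-Selmer coordinates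
  (the card's «`κ₂(R_n)κ₂(R_n)ᵀ ≡ adj(C_n)`»); ★★ `odd_iff_exists_kummer_eq_torsion_add_adjugate{,_of_selmerFour}` — a rational point
  is outside `E[2] + 2E` IFF its class is a torsion class plus `v` (C⁺-type oddness ⟺ three entry laws); `genTorsion_of_independent_of_selmerTwo`
  (independence ⟹ generation: `hgenK` from seven non-membership checks); ★★ `exists_adjugate_pin_on_jumpOne_class` — the package ON
  THE BINDERS OF ITEM 23431 (analytic rank one via GZK; the Cassels–Tate form of `exists_ctSelmer_two`, values in `ℚ/ℤ`).

So for the analytic side (pieces (G)/(I) of the card): a rational point `y` of the jump-one class lies outside `E_n(ℚ)[2] + 2E_n(ℚ)`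
(C⁺-type oddness; cf. g20 p775690 «C⁺ ⟺ [P(n)] ≠ 0» on R2) iff its `2`-Selmer coordinates modulo torsion classes are
`([c₂₃ ≠ 0], [c₁₃ ≠ 0], [c₁₂ ≠ 0])` — three ENTRY LAWS, the card's C⁺⁺ shape; uses `#Sel₄ = 2⁶` (p770682 honoured).
References: Cassels 1998; Milne *ADT* I §6; Silverman *AEC* VIII §2, X §4; Heath-Brown 1994 §1; the card's Addendum.
-/

noncomputable section

open scoped Classical

open WeierstrassCurve Literature.NumberTheory.EllipticCurves Summit.BirchSwinnertonDyer.PrintCf2.CasselsTatePin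

set_option autoImplicit false

namespace Summit.BirchSwinnertonDyer.PrintCf2.AdjugatePin

/-! ## §2 The congruent number curve: category D of rank one and the jump-one class -/

section CongruentNumber

variable {n : ℕ} {T : Type*} [AddCommGroup T]

/-- **`#Sel₄(E_n) = 2⁸ ⟺ c₁₂ = c₁₃ = c₂₃ = 0`** on category D of rank one (square-free `n`, `rank E_n(ℚ) = 1`, `#Sel₂(E_n) = 2⁵`): for
any alternating `C` on `Sel₂(E_n)` with left kernel `[2]_* Sel₄(E_n)` and any three Selmer classes generating `Sel₂(E_n)` over Kummer
classes, the census B-label is the CONJUNCTION of the three entries. [cite: MilneADT2006, Ch. I §6 Lemma 6.17]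
[cite: HeathBrown1994SelmerCongruentII, §1] -/
theorem natCard_selmerGroup_four_eq_two_pow_eight_iff_entries (hsq : Squarefree n) [(congruentNumberCurve n).IsElliptic]
    (hr : (congruentNumberCurve n).mordellWeilRank = 1)
    (h₂ : Nat.card ((congruentNumberCurve n).selmerGroup 2) = 2 ^ 5)
    (C : selmerGroup (congruentNumberCurve n) 2 →+ selmerGroup (congruentNumberCurve n) 2 →+ T) (halt : ∀ s, C s s = 0)
    (hl : ∀ s, (∀ t, C s t = 0) ↔
      s ∈ (selmerZSMul (congruentNumberCurve n) (d := 2) (n := 4) 2 four_dvd_two_mul_two).range)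
    (hdiv : ∀ P : geomPoints (congruentNumberCurve n), ∃ Q : geomPoints (congruentNumberCurve n), (2 : ℤ) • Q = P)
    (s₁ s₂ s₃ : selmerGroup (congruentNumberCurve n) 2)
    (hgen : ∀ t : selmerGroup (congruentNumberCurve n) 2, ∃ (P : (congruentNumberCurve n).toAffine.Point) (b₁ b₂ b₃ : ℤ),
      (t : galH1Torsion (congruentNumberCurve n) 2) = kummerMapTorsion (congruentNumberCurve n) 2 hdiv P +
        ((b₁ • s₁ + b₂ • s₂ + b₃ • s₃ : selmerGroup (congruentNumberCurve n) 2) : galH1Torsion (congruentNumberCurve n) 2)) :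
    Nat.card ((congruentNumberCurve n).selmerGroup 4) = 2 ^ 8 ↔ (C s₁ s₂ = 0 ∧ C s₁ s₃ = 0 ∧ C s₂ s₃ = 0) :=
  (forall_forall_apply_eq_zero_iff_selmerFour hsq hr h₂ C hl).symm.trans
    (forall_forall_apply_eq_zero_iff_entries (congruentNumberCurve n) C halt hl hdiv s₁ s₂ s₃ hgen)

/-- **On the jump-one class not all three entries vanish** (`#Sel₄(E_n) = 2⁶ ≠ 2⁸`). [cite: MilneADT2006, Ch. I §6 Lemma 6.17]
[cite: HeathBrown1994SelmerCongruentII, §1] -/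
theorem entries_ne_zero_of_selmerFour (hsq : Squarefree n) [(congruentNumberCurve n).IsElliptic]
    (hr : (congruentNumberCurve n).mordellWeilRank = 1)
    (h₂ : Nat.card ((congruentNumberCurve n).selmerGroup 2) = 2 ^ 5)
    (h₄ : Nat.card ((congruentNumberCurve n).selmerGroup 4) = 2 ^ 6)
    (C : selmerGroup (congruentNumberCurve n) 2 →+ selmerGroup (congruentNumberCurve n) 2 →+ T) (halt : ∀ s, C s s = 0)
    (hl : ∀ s, (∀ t, C s t = 0) ↔
      s ∈ (selmerZSMul (congruentNumberCurve n) (d := 2) (n := 4) 2 four_dvd_two_mul_two).range)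
    (hdiv : ∀ P : geomPoints (congruentNumberCurve n), ∃ Q : geomPoints (congruentNumberCurve n), (2 : ℤ) • Q = P)
    (s₁ s₂ s₃ : selmerGroup (congruentNumberCurve n) 2)
    (hgen : ∀ t : selmerGroup (congruentNumberCurve n) 2, ∃ (P : (congruentNumberCurve n).toAffine.Point) (b₁ b₂ b₃ : ℤ),
      (t : galH1Torsion (congruentNumberCurve n) 2) = kummerMapTorsion (congruentNumberCurve n) 2 hdiv P +
        ((b₁ • s₁ + b₂ • s₂ + b₃ • s₃ : selmerGroup (congruentNumberCurve n) 2) : galH1Torsion (congruentNumberCurve n) 2)) :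
    ¬ (C s₁ s₂ = 0 ∧ C s₁ s₃ = 0 ∧ C s₂ s₃ = 0) := by
  intro h
  have h8 := (natCard_selmerGroup_four_eq_two_pow_eight_iff_entries hsq hr h₂ C halt hl hdiv s₁ s₂ s₃ hgen).mpr h
  rw [h₄] at h8
  norm_num at h8

/-- ★ **Existence half on the jump-one class**: for square-free `n` with `rank E_n(ℚ) = 1`, `#Sel₂(E_n) = 2⁵`, `#Sel₄(E_n) = 2⁶`, any
alternating `C` on `Sel₂(E_n)` with left kernel `[2]_* Sel₄(E_n)` (values with collinear `2`-torsion) and three Selmer classes generating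
over Kummer classes: **some rational point `P` has `κ₂(P) = [c₂₃ ≠ 0]s₁ + [c₁₃ ≠ 0]s₂ + [c₁₂ ≠ 0]s₃`.**
[cite: MilneADT2006, Ch. I §6 Thm. 6.13(a), Lemma 6.17] [cite: MorganSmith2021CTP, Thm. 1.3 with Ex. 1.4] [cite: SilvermanAEC2009, Thm. X.4.2(a)] -/
theorem exists_kummer_eq_adjugate_of_selmerFour (hsq : Squarefree n) [(congruentNumberCurve n).IsElliptic]
    (hr : (congruentNumberCurve n).mordellWeilRank = 1)
    (h₂ : Nat.card ((congruentNumberCurve n).selmerGroup 2) = 2 ^ 5)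
    (h₄ : Nat.card ((congruentNumberCurve n).selmerGroup 4) = 2 ^ 6)
    (C : selmerGroup (congruentNumberCurve n) 2 →+ selmerGroup (congruentNumberCurve n) 2 →+ T) (halt : ∀ s, C s s = 0)
    (hl : ∀ s, (∀ t, C s t = 0) ↔
      s ∈ (selmerZSMul (congruentNumberCurve n) (d := 2) (n := 4) 2 four_dvd_two_mul_two).range)
    (hT : ∀ x y : T, (2 : ℕ) • x = 0 → (2 : ℕ) • y = 0 → x = 0 ∨ y = 0 ∨ x = y)
    (hdiv : ∀ P : geomPoints (congruentNumberCurve n), ∃ Q : geomPoints (congruentNumberCurve n), (2 : ℤ) • Q = P)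
    (s₁ s₂ s₃ v : selmerGroup (congruentNumberCurve n) 2)
    (hv : v = (if C s₂ s₃ = 0 then 0 else s₁) + (if C s₁ s₃ = 0 then 0 else s₂) + (if C s₁ s₂ = 0 then 0 else s₃))
    (hgen : ∀ t : selmerGroup (congruentNumberCurve n) 2, ∃ (P : (congruentNumberCurve n).toAffine.Point) (b₁ b₂ b₃ : ℤ),
      (t : galH1Torsion (congruentNumberCurve n) 2) = kummerMapTorsion (congruentNumberCurve n) 2 hdiv P +
        ((b₁ • s₁ + b₂ • s₂ + b₃ • s₃ : selmerGroup (congruentNumberCurve n) 2) : galH1Torsion (congruentNumberCurve n) 2)) :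
    ∃ P : (congruentNumberCurve n).toAffine.Point,
      kummerMapTorsion (congruentNumberCurve n) 2 hdiv P = (v : galH1Torsion (congruentNumberCurve n) 2) :=
  exists_kummer_eq_adjugate (congruentNumberCurve n) C halt hl hT
    ((natCard_selmerGroup_four_eq_two_pow_six_iff hsq hr h₂).mp h₄) hdiv s₁ s₂ s₃ v hv hgen

/-- `16 < 2⁵` (kept outside the classical-priority section below, whose `Decidable` instances would defeat `decide`-based
numerals). [folklore] -/
theorem sixteen_lt_two_pow_five : 16 < 2 ^ 5 := by norm_num


/-- `2⁵ = 4 · 8` (outside the classical-priority section). [folklore] -/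
theorem two_pow_five_eq : 2 ^ 5 = 4 * 8 := by norm_num

/-- **`E_n(ℚ)` has no point of order `4`**: `4Q = 0 ⟹ 2Q = 0` for square-free `n` (`E_n(ℚ)[4] = E_n(ℚ)[2]`,
`torsionBy_congruentNumberCurve_eq_torsionBy_two`). Stated with `ℚ`'s own `DecidableEq` (as the tree lemma); §3 bridges by `convert`.
[cite: Knapp1993, Lemma 4.20] -/
theorem two_smul_eq_zero_of_four_smul_eq_zero (hsq : Squarefree n) (Q : (congruentNumberCurve n).toAffine.Point)
    (h4 : (4 : ℤ) • Q = 0) : (2 : ℤ) • Q = 0 := by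
  have hmem : Q ∈ AddSubgroup.torsionBy (congruentNumberCurve n).toAffine.Point ((4 : ℕ) : ℤ) :=
    (Submodule.mem_torsionBy_iff (R := ℤ) _ _).mpr (by exact_mod_cast h4)
  rw [torsionBy_congruentNumberCurve_eq_torsionBy_two hsq (m := 4) ⟨2, rfl⟩ four_ne_zero] at hmem
  exact (Submodule.mem_torsionBy_iff (R := ℤ) _ _).mp hmem

end CongruentNumber

/-! ## §3 The jump-one class: statements with point arithmetic

The group law on `E_n(ℚ)` in the tree's generic lemmas (Kummer map, `kummerMapTorsion_ker`, `natCard_torsionBy_two_le`) carries the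
CLASSICAL `DecidableEq` on the base field; the statements below are elaborated with that instance (local priority bump), so that they
compose with the generic §1 without instance transport. Consumers working with `ℚ`'s own `DecidableEq` bridge with `convert`
(`DecidableEq` is a subsingleton), as `Smith2016.natCard_torsionBy_two_congruentNumberCurve` is bridged here. -/

section JumpOne

attribute [local instance 10000] Classical.propDecidable

variable {n : ℕ} {T : Type*} [AddCommGroup T]

/-- `E_n(ℚ)[2]` is finite (it has `4` elements, `Smith2016.natCard_torsionBy_two_congruentNumberCurve`; instance bridge by `convert`).
[cite: SilvermanAEC2009, Cor. III.6.4(b)] -/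
theorem finite_torsionBy_two_congruentNumberCurve (hn : n ≠ 0) [(congruentNumberCurve n).IsElliptic] :
    Finite (AddSubgroup.torsionBy (congruentNumberCurve n).toAffine.Point (2 : ℤ)) := by
  have h4 : Nat.card (AddSubgroup.torsionBy (congruentNumberCurve n).toAffine.Point (2 : ℤ)) = 4 := by
    convert Smith2016.natCard_torsionBy_two_congruentNumberCurve hn
  exact Nat.finite_of_card_ne_zero (by rw [h4]; exact four_ne_zero)


/-- **INDEPENDENCE ⟹ GENERATION over torsion classes, for `E_n` on category D** (how a consumer with an explicit symbol basis discharges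
the hypothesis `hgenK` of the adjugate pin): for square-free `n` with `#Sel₂(E_n) = 2⁵` and three Selmer classes `s₁ s₂ s₃` such that NO
non-trivial `{0,1}`-combination is the Kummer class of a rational `2`-torsion point (`8 − 1 = 7` non-membership checks against the `4`
torsion classes), every `2`-Selmer class is a torsion class plus a combination of `s₁ s₂ s₃` (`#E_n(ℚ)[2] = 4`, no rational `4`-torsion,
`32 = 4 · 8`). [cite: HeathBrown1994SelmerCongruentII, §1] [cite: SilvermanAEC2009, Thm. X.4.2(a), Cor. III.6.4(b)] [cite: Knapp1993, Lemma 4.20] -/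
theorem genTorsion_of_independent_of_selmerTwo (hsq : Squarefree n) [(congruentNumberCurve n).IsElliptic]
    (h₂ : Nat.card ((congruentNumberCurve n).selmerGroup 2) = 2 ^ 5)
    (hdiv : ∀ P : geomPoints (congruentNumberCurve n), ∃ Q : geomPoints (congruentNumberCurve n), (2 : ℤ) • Q = P)
    (s₁ s₂ s₃ : selmerGroup (congruentNumberCurve n) 2)
    (hind : ∀ (T : (congruentNumberCurve n).toAffine.Point) (ε₁ ε₂ ε₃ : Bool), (2 : ℤ) • T = 0 →
      kummerMapTorsion (congruentNumberCurve n) 2 hdiv T =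
        (((bif ε₁ then s₁ else 0) + (bif ε₂ then s₂ else 0) + (bif ε₃ then s₃ else 0) :
          selmerGroup (congruentNumberCurve n) 2) : galH1Torsion (congruentNumberCurve n) 2) →
      ε₁ = false ∧ ε₂ = false ∧ ε₃ = false)
    (t : selmerGroup (congruentNumberCurve n) 2) :
    ∃ (P : (congruentNumberCurve n).toAffine.Point) (b₁ b₂ b₃ : ℤ), (2 : ℤ) • P = 0 ∧
      (t : galH1Torsion (congruentNumberCurve n) 2) = kummerMapTorsion (congruentNumberCurve n) 2 hdiv P +
        ((b₁ • s₁ + b₂ • s₂ + b₃ • s₃ : selmerGroup (congruentNumberCurve n) 2) : galH1Torsion (congruentNumberCurve n) 2) := by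
  haveI := finite_torsionBy_two_congruentNumberCurve hsq.ne_zero
  have h4 : Nat.card (AddSubgroup.torsionBy (congruentNumberCurve n).toAffine.Point (2 : ℤ)) = 4 := by
    convert Smith2016.natCard_torsionBy_two_congruentNumberCurve hsq.ne_zero
  refine genTorsion_of_independent (congruentNumberCurve n) hdiv s₁ s₂ s₃ (by rw [h₂, h4, two_pow_five_eq])
    (fun T hT hκ => ?_) hind t
  -- no rational `4`-torsion: `κ₂ T = 0 ⟹ T = 2Q`, `4Q = 2T = 0 ⟹ 2Q = 0 ⟹ T = 0`
  have hker : T ∈ (kummerMapTorsion (congruentNumberCurve n) 2 hdiv).ker := hκ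
  rw [kummerMapTorsion_ker] at hker
  obtain ⟨Q, hQ⟩ := hker
  have hQT : (2 : ℤ) • Q = T := hQ
  have h4Q : (4 : ℤ) • Q = 0 := by
    rw [show (4 : ℤ) = 2 * 2 by norm_num, mul_smul, hQT, hT]
  have h2Q : (2 : ℤ) • Q = 0 := by
    convert two_smul_eq_zero_of_four_smul_eq_zero hsq Q (by convert h4Q)
  rw [← hQT, h2Q]

/-- ★ **ADJUGATE PIN on the jump-one class — uniqueness**: for square-free `n` with `rank E_n(ℚ) = 1`, `#Sel₂(E_n) = 2⁵`,
`#Sel₄(E_n) = 2⁶`, any alternating `C` on `Sel₂(E_n)` with left kernel `[2]_* Sel₄(E_n)` (values with collinear `2`-torsion) and three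
Selmer classes `s₁ s₂ s₃` generating `Sel₂(E_n)` over the torsion classes `κ₂(E_n(ℚ)[2])`: **every rational point `P` has
`κ₂(P) = κ₂(T)` or `κ₂(P) = κ₂(T) + v` for a rational `2`-torsion point `T`**, `v = [c₂₃ ≠ 0]s₁ + [c₁₃ ≠ 0]s₂ + [c₁₂ ≠ 0]s₃`.
[cite: MilneADT2006, Ch. I §6 Lemma 6.17] [cite: SilvermanAEC2009, Thm. X.4.2(a)] [cite: HeathBrown1994SelmerCongruentII, §1] -/
theorem kummer_eq_or_eq_add_adjugate_of_selmerFour (hsq : Squarefree n) [(congruentNumberCurve n).IsElliptic]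
    (hr : (congruentNumberCurve n).mordellWeilRank = 1)
    (h₂ : Nat.card ((congruentNumberCurve n).selmerGroup 2) = 2 ^ 5)
    (h₄ : Nat.card ((congruentNumberCurve n).selmerGroup 4) = 2 ^ 6)
    (C : selmerGroup (congruentNumberCurve n) 2 →+ selmerGroup (congruentNumberCurve n) 2 →+ T) (halt : ∀ s, C s s = 0)
    (hl : ∀ s, (∀ t, C s t = 0) ↔
      s ∈ (selmerZSMul (congruentNumberCurve n) (d := 2) (n := 4) 2 four_dvd_two_mul_two).range)
    (hT : ∀ x y : T, (2 : ℕ) • x = 0 → (2 : ℕ) • y = 0 → x = 0 ∨ y = 0 ∨ x = y)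
    (hdiv : ∀ P : geomPoints (congruentNumberCurve n), ∃ Q : geomPoints (congruentNumberCurve n), (2 : ℤ) • Q = P)
    (s₁ s₂ s₃ v : selmerGroup (congruentNumberCurve n) 2)
    (hv : v = (if C s₂ s₃ = 0 then 0 else s₁) + (if C s₁ s₃ = 0 then 0 else s₂) + (if C s₁ s₂ = 0 then 0 else s₃))
    (hgenK : ∀ t : selmerGroup (congruentNumberCurve n) 2, ∃ (P : (congruentNumberCurve n).toAffine.Point) (b₁ b₂ b₃ : ℤ),
      (2 : ℤ) • P = 0 ∧ (t : galH1Torsion (congruentNumberCurve n) 2) = kummerMapTorsion (congruentNumberCurve n) 2 hdiv P +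
        ((b₁ • s₁ + b₂ • s₂ + b₃ • s₃ : selmerGroup (congruentNumberCurve n) 2) : galH1Torsion (congruentNumberCurve n) 2))
    (P : (congruentNumberCurve n).toAffine.Point) :
    ∃ T₀ : (congruentNumberCurve n).toAffine.Point, (2 : ℤ) • T₀ = 0 ∧
      (kummerMapTorsion (congruentNumberCurve n) 2 hdiv P = kummerMapTorsion (congruentNumberCurve n) 2 hdiv T₀ ∨
        kummerMapTorsion (congruentNumberCurve n) 2 hdiv P = kummerMapTorsion (congruentNumberCurve n) 2 hdiv T₀ +
          (v : galH1Torsion (congruentNumberCurve n) 2)) :=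
  kummer_eq_or_eq_add_adjugate (congruentNumberCurve n) C halt hl hT hdiv s₁ s₂ s₃ v hv
    (entries_ne_zero_of_selmerFour hsq hr h₂ h₄ C halt hl hdiv s₁ s₂ s₃
      (fun t => by obtain ⟨P, b₁, b₂, b₃, -, h⟩ := hgenK t; exact ⟨P, b₁, b₂, b₃, h⟩)) hgenK P

/-- ★★ **ADJUGATE PIN on the jump-one class — THE ENTRIES NAME THE GENERATOR**: for square-free `n` with `rank E_n(ℚ) = 1`,
`#Sel₂(E_n) = 2⁵`, `#Sel₄(E_n) = 2⁶`, any alternating `C` on `Sel₂(E_n)` with left kernel `[2]_* Sel₄(E_n)` (values with collinear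
`2`-torsion) and three Selmer classes `s₁ s₂ s₃` generating `Sel₂(E_n)` over the torsion classes: **there is a rational point
`P ∉ E_n(ℚ)[2] + 2E_n(ℚ)` — an odd multiple of the Mordell–Weil generator up to torsion (`E_n(ℚ)_tors = E_n[2]`) — whose Kummer
class is the adjugate vector `[c₂₃ ≠ 0]s₁ + [c₁₃ ≠ 0]s₂ + [c₁₂ ≠ 0]s₃`**; and by the uniqueness half every point outside
`E_n(ℚ)[2] + 2E_n(ℚ)` has that class modulo torsion classes. The card's «`κ₂(R_n)κ₂(R_n)ᵀ ≡ adj(C_n)`».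
[cite: MilneADT2006, Ch. I §6 Thm. 6.13(a), Lemma 6.17] [cite: MorganSmith2021CTP, Thm. 1.3 with Ex. 1.4]
[cite: SilvermanAEC2009, Thm. X.4.2(a), Cor. III.6.4(b)] [cite: HeathBrown1994SelmerCongruentII, §1] -/
theorem exists_odd_point_kummer_eq_adjugate_of_selmerFour (hsq : Squarefree n) [(congruentNumberCurve n).IsElliptic]
    (hr : (congruentNumberCurve n).mordellWeilRank = 1)
    (h₂ : Nat.card ((congruentNumberCurve n).selmerGroup 2) = 2 ^ 5)
    (h₄ : Nat.card ((congruentNumberCurve n).selmerGroup 4) = 2 ^ 6)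
    (C : selmerGroup (congruentNumberCurve n) 2 →+ selmerGroup (congruentNumberCurve n) 2 →+ T) (halt : ∀ s, C s s = 0)
    (hl : ∀ s, (∀ t, C s t = 0) ↔
      s ∈ (selmerZSMul (congruentNumberCurve n) (d := 2) (n := 4) 2 four_dvd_two_mul_two).range)
    (hT : ∀ x y : T, (2 : ℕ) • x = 0 → (2 : ℕ) • y = 0 → x = 0 ∨ y = 0 ∨ x = y)
    (hdiv : ∀ P : geomPoints (congruentNumberCurve n), ∃ Q : geomPoints (congruentNumberCurve n), (2 : ℤ) • Q = P)
    (s₁ s₂ s₃ v : selmerGroup (congruentNumberCurve n) 2)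
    (hv : v = (if C s₂ s₃ = 0 then 0 else s₁) + (if C s₁ s₃ = 0 then 0 else s₂) + (if C s₁ s₂ = 0 then 0 else s₃))
    (hgenK : ∀ t : selmerGroup (congruentNumberCurve n) 2, ∃ (P : (congruentNumberCurve n).toAffine.Point) (b₁ b₂ b₃ : ℤ),
      (2 : ℤ) • P = 0 ∧ (t : galH1Torsion (congruentNumberCurve n) 2) = kummerMapTorsion (congruentNumberCurve n) 2 hdiv P +
        ((b₁ • s₁ + b₂ • s₂ + b₃ • s₃ : selmerGroup (congruentNumberCurve n) 2) : galH1Torsion (congruentNumberCurve n) 2)) :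
    ∃ P : (congruentNumberCurve n).toAffine.Point,
      kummerMapTorsion (congruentNumberCurve n) 2 hdiv P = (v : galH1Torsion (congruentNumberCurve n) 2) ∧
        ∀ T₀ Q : (congruentNumberCurve n).toAffine.Point, (2 : ℤ) • T₀ = 0 → P ≠ T₀ + (2 : ℤ) • Q := by
  haveI := finite_torsionBy_two_congruentNumberCurve hsq.ne_zero
  exact exists_odd_point_kummer_eq_adjugate (congruentNumberCurve n) C halt hl hT
    ((natCard_selmerGroup_four_eq_two_pow_six_iff hsq hr h₂).mp h₄) hdiv s₁ s₂ s₃ v hv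
    (entries_ne_zero_of_selmerFour hsq hr h₂ h₄ C halt hl hdiv s₁ s₂ s₃
      (fun t => by obtain ⟨P, b₁, b₂, b₃, -, h⟩ := hgenK t; exact ⟨P, b₁, b₂, b₃, h⟩))
    (h₂ ▸ sixteen_lt_two_pow_five) hgenK


/-- ★★ **ODDNESS ⟺ THE THREE ENTRY LAWS** (any `E/K`; the point-level dictionary «C⁺ ⟺ C⁺⁺»): under the hypotheses of
`exists_odd_point_kummer_eq_adjugate` minus `Ш[4] = Ш[2]` (not all entries zero, `#Sel₂ > 16`, generators over torsion classes), a rational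
point `y` lies OUTSIDE `E(K)[2] + 2E(K)` iff its Kummer class is a torsion class plus the adjugate vector `v` — i.e. iff its three
`2`-Selmer coordinates modulo torsion classes are `([c₂₃ ≠ 0], [c₁₃ ≠ 0], [c₁₂ ≠ 0])`. [cite: SilvermanAEC2009, VIII.§2, Thm. X.4.2(a)]
[cite: MilneADT2006, Ch. I §6 Lemma 6.17] -/
theorem odd_iff_exists_kummer_eq_torsion_add_adjugate {K : Type*} [Field K] [NumberField K] (W : WeierstrassCurve K) [W.IsElliptic]
    (C : selmerGroup W 2 →+ selmerGroup W 2 →+ T) (halt : ∀ s, C s s = 0)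
    (hl : ∀ s, (∀ t, C s t = 0) ↔ s ∈ (selmerZSMul W (d := 2) (n := 4) 2 four_dvd_two_mul_two).range)
    (hT : ∀ x y : T, (2 : ℕ) • x = 0 → (2 : ℕ) • y = 0 → x = 0 ∨ y = 0 ∨ x = y)
    (hdiv : ∀ P : geomPoints W, ∃ Q : geomPoints W, (2 : ℤ) • Q = P) (s₁ s₂ s₃ v : selmerGroup W 2)
    (hv : v = (if C s₂ s₃ = 0 then 0 else s₁) + (if C s₁ s₃ = 0 then 0 else s₂) + (if C s₁ s₂ = 0 then 0 else s₃))
    (hne : ¬ (C s₁ s₂ = 0 ∧ C s₁ s₃ = 0 ∧ C s₂ s₃ = 0))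
    [Finite (AddSubgroup.torsionBy W.toAffine.Point (2 : ℤ))] (h16 : 16 < Nat.card (selmerGroup W 2))
    (hgenK : ∀ t : selmerGroup W 2, ∃ (P : W.toAffine.Point) (b₁ b₂ b₃ : ℤ), (2 : ℤ) • P = 0 ∧
      (t : galH1Torsion W 2) = kummerMapTorsion W 2 hdiv P + ((b₁ • s₁ + b₂ • s₂ + b₃ • s₃ : selmerGroup W 2) : galH1Torsion W 2))
    (y : W.toAffine.Point) :
    (∀ T₀ Q : W.toAffine.Point, (2 : ℤ) • T₀ = 0 → y ≠ T₀ + (2 : ℤ) • Q) ↔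
      ∃ T₀ : W.toAffine.Point, (2 : ℤ) • T₀ = 0 ∧
        kummerMapTorsion W 2 hdiv y = kummerMapTorsion W 2 hdiv T₀ + (v : galH1Torsion W 2) := by
  constructor
  · intro hodd
    obtain ⟨T₀, hT₀, h | h⟩ := kummer_eq_or_eq_add_adjugate W C halt hl hT hdiv s₁ s₂ s₃ v hv hne hgenK y
    · obtain ⟨T, Q, hT2, hyTQ⟩ := (even_iff_kummer_eq_torsion_class W hdiv y).mpr ⟨T₀, hT₀, h⟩
      exact absurd hyTQ (hodd T Q hT2)
    · exact ⟨T₀, hT₀, h⟩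
  · rintro ⟨T₀, hT₀, hy⟩ T Q hT2 hyTQ
    obtain ⟨T', hT', hyT'⟩ := (even_iff_kummer_eq_torsion_class W hdiv y).mp ⟨T, Q, hT2, hyTQ⟩
    -- `v = κ₂(T' − T₀)`, a torsion class: impossible
    have h2 : (2 : ℤ) • (T' - T₀) = 0 := by rw [smul_sub, hT', hT₀, sub_zero]
    refine kummer_ne_adjugate_of_two_torsion W C hdiv s₁ s₂ s₃ v hv hne h16 hgenK (T' - T₀) h2 ?_
    rw [map_sub, ← hyT', hy, add_sub_cancel_left]

/-- ★★ **ODDNESS ⟺ THE THREE ENTRY LAWS on the jump-one class of `E_n`**: for square-free `n` with `rank E_n(ℚ) = 1`, `#Sel₂(E_n) = 2⁵`,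
`#Sel₄(E_n) = 2⁶`, any alternating `C` on `Sel₂(E_n)` with left kernel `[2]_* Sel₄(E_n)` (values with collinear `2`-torsion) and three
Selmer classes generating over the torsion classes: a rational point `y` is NOT in `E_n(ℚ)[2] + 2E_n(ℚ)` (C⁺-type oddness of a
Heegner-type point, cf. p775690) **iff** `κ₂(y) = κ₂(T) + [c₂₃ ≠ 0]s₁ + [c₁₃ ≠ 0]s₂ + [c₁₂ ≠ 0]s₃` for a rational `2`-torsion `T` — the
card's C⁺⁺ shape (three entry laws) is EQUIVALENT to oddness, not merely sufficient. [cite: SilvermanAEC2009, VIII.§2, Thm. X.4.2(a)]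
[cite: MilneADT2006, Ch. I §6 Lemma 6.17] [cite: HeathBrown1994SelmerCongruentII, §1] -/
theorem odd_iff_exists_kummer_eq_torsion_add_adjugate_of_selmerFour (hsq : Squarefree n) [(congruentNumberCurve n).IsElliptic]
    (hr : (congruentNumberCurve n).mordellWeilRank = 1)
    (h₂ : Nat.card ((congruentNumberCurve n).selmerGroup 2) = 2 ^ 5)
    (h₄ : Nat.card ((congruentNumberCurve n).selmerGroup 4) = 2 ^ 6)
    (C : selmerGroup (congruentNumberCurve n) 2 →+ selmerGroup (congruentNumberCurve n) 2 →+ T) (halt : ∀ s, C s s = 0)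
    (hl : ∀ s, (∀ t, C s t = 0) ↔
      s ∈ (selmerZSMul (congruentNumberCurve n) (d := 2) (n := 4) 2 four_dvd_two_mul_two).range)
    (hT : ∀ x y : T, (2 : ℕ) • x = 0 → (2 : ℕ) • y = 0 → x = 0 ∨ y = 0 ∨ x = y)
    (hdiv : ∀ P : geomPoints (congruentNumberCurve n), ∃ Q : geomPoints (congruentNumberCurve n), (2 : ℤ) • Q = P)
    (s₁ s₂ s₃ v : selmerGroup (congruentNumberCurve n) 2)
    (hv : v = (if C s₂ s₃ = 0 then 0 else s₁) + (if C s₁ s₃ = 0 then 0 else s₂) + (if C s₁ s₂ = 0 then 0 else s₃))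
    (hgenK : ∀ t : selmerGroup (congruentNumberCurve n) 2, ∃ (P : (congruentNumberCurve n).toAffine.Point) (b₁ b₂ b₃ : ℤ),
      (2 : ℤ) • P = 0 ∧ (t : galH1Torsion (congruentNumberCurve n) 2) = kummerMapTorsion (congruentNumberCurve n) 2 hdiv P +
        ((b₁ • s₁ + b₂ • s₂ + b₃ • s₃ : selmerGroup (congruentNumberCurve n) 2) : galH1Torsion (congruentNumberCurve n) 2))
    (y : (congruentNumberCurve n).toAffine.Point) :
    (∀ T₀ Q : (congruentNumberCurve n).toAffine.Point, (2 : ℤ) • T₀ = 0 → y ≠ T₀ + (2 : ℤ) • Q) ↔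
      ∃ T₀ : (congruentNumberCurve n).toAffine.Point, (2 : ℤ) • T₀ = 0 ∧
        kummerMapTorsion (congruentNumberCurve n) 2 hdiv y =
          kummerMapTorsion (congruentNumberCurve n) 2 hdiv T₀ + (v : galH1Torsion (congruentNumberCurve n) 2) := by
  haveI := finite_torsionBy_two_congruentNumberCurve hsq.ne_zero
  exact odd_iff_exists_kummer_eq_torsion_add_adjugate (congruentNumberCurve n) C halt hl hT hdiv s₁ s₂ s₃ v hv
    (entries_ne_zero_of_selmerFour hsq hr h₂ h₄ C halt hl hdiv s₁ s₂ s₃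
      (fun t => by obtain ⟨P, b₁, b₂, b₃, -, h⟩ := hgenK t; exact ⟨P, b₁, b₂, b₃, h⟩))
    (h₂ ▸ sixteen_lt_two_pow_five) hgenK y

/-- ★★ **THE ADJUGATE PIN ON THE C⁺ CLASS OF ITEM 23431, BY ITS BINDERS** (granted GZK = conjunct 1 of `𝔅_ram` for rank one, and the
CT fact for the existence of the form): for square-free `n` with `ord_{s=1} L(E_n, s) = 1`, `#Sel₂(E_n) = 2⁵`, `#Sel₄(E_n) = 2⁶` there is
an ALTERNATING bi-additive form `C` on `Sel₂(E_n)` with values in `ℚ/ℤ` (the Cassels–Tate form of `exists_ctSelmer_two`) such that for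
EVERY three Selmer classes `s₁ s₂ s₃` generating `Sel₂(E_n)` over the torsion classes: (i) not all three entries `⟨sᵢ, sⱼ⟩` vanish;
(ii) some rational point outside `E_n(ℚ)[2] + 2E_n(ℚ)` has Kummer class the adjugate vector `[c₂₃ ≠ 0]s₁ + [c₁₃ ≠ 0]s₂ + [c₁₂ ≠ 0]s₃`;
(iii) every rational point's Kummer class is a torsion class or a torsion class plus the adjugate vector.
[cite: MilneADT2006, Ch. I §6 Thm. 6.13(a), Lemma 6.17] [cite: MorganSmith2021CTP, Thm. 1.3 with Ex. 1.4] [cite: Cassels1962ArithmeticIV]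
[cite: SilvermanAEC2009, Thm. X.4.2(a)] -/
theorem exists_adjugate_pin_on_jumpOne_class (hGZK : rank_eq_analyticRank_of_analyticRank_le_one)
    (hCT : casselsTate_pairing_levelKernel ℚ) (hsq : Squarefree n) [(congruentNumberCurve n).IsElliptic]
    (hra : (congruentNumberCurve n).analyticRank = 1)
    (h₂ : Nat.card ((congruentNumberCurve n).selmerGroup 2) = 2 ^ 5)
    (h₄ : Nat.card ((congruentNumberCurve n).selmerGroup 4) = 2 ^ 6)
    (hdiv : ∀ P : geomPoints (congruentNumberCurve n), ∃ Q : geomPoints (congruentNumberCurve n), (2 : ℤ) • Q = P) :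
    ∃ C : selmerGroup (congruentNumberCurve n) 2 →+ selmerGroup (congruentNumberCurve n) 2 →+ AddCircle (1 : ℚ),
      (∀ s, C s s = 0) ∧
        ∀ s₁ s₂ s₃ : selmerGroup (congruentNumberCurve n) 2,
          (∀ t : selmerGroup (congruentNumberCurve n) 2, ∃ (P : (congruentNumberCurve n).toAffine.Point) (b₁ b₂ b₃ : ℤ),
            (2 : ℤ) • P = 0 ∧ (t : galH1Torsion (congruentNumberCurve n) 2) = kummerMapTorsion (congruentNumberCurve n) 2 hdiv P +
              ((b₁ • s₁ + b₂ • s₂ + b₃ • s₃ : selmerGroup (congruentNumberCurve n) 2) : galH1Torsion (congruentNumberCurve n) 2)) →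
          ¬ (C s₁ s₂ = 0 ∧ C s₁ s₃ = 0 ∧ C s₂ s₃ = 0) ∧
            (∃ P : (congruentNumberCurve n).toAffine.Point,
              kummerMapTorsion (congruentNumberCurve n) 2 hdiv P =
                (((if C s₂ s₃ = 0 then 0 else s₁) + (if C s₁ s₃ = 0 then 0 else s₂) + (if C s₁ s₂ = 0 then 0 else s₃) :
                  selmerGroup (congruentNumberCurve n) 2) : galH1Torsion (congruentNumberCurve n) 2) ∧
              ∀ T₀ Q : (congruentNumberCurve n).toAffine.Point, (2 : ℤ) • T₀ = 0 → P ≠ T₀ + (2 : ℤ) • Q) ∧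
            ∀ P : (congruentNumberCurve n).toAffine.Point, ∃ T₀ : (congruentNumberCurve n).toAffine.Point, (2 : ℤ) • T₀ = 0 ∧
              (kummerMapTorsion (congruentNumberCurve n) 2 hdiv P = kummerMapTorsion (congruentNumberCurve n) 2 hdiv T₀ ∨
                kummerMapTorsion (congruentNumberCurve n) 2 hdiv P = kummerMapTorsion (congruentNumberCurve n) 2 hdiv T₀ +
                  (((if C s₂ s₃ = 0 then 0 else s₁) + (if C s₁ s₃ = 0 then 0 else s₂) + (if C s₁ s₂ = 0 then 0 else s₃) :
                    selmerGroup (congruentNumberCurve n) 2) : galH1Torsion (congruentNumberCurve n) 2)) := by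
  have hr : (congruentNumberCurve n).mordellWeilRank = 1 := ((hGZK (congruentNumberCurve n) hra.le).1).trans hra
  obtain ⟨C, halt, hl, -⟩ := exists_ctSelmer_two hCT (congruentNumberCurve n)
  have hT := AdjugateForm.addCircle_two_torsion_collinear
  refine ⟨C, halt, fun s₁ s₂ s₃ hgenK => ⟨?_, ?_, ?_⟩⟩
  · exact entries_ne_zero_of_selmerFour hsq hr h₂ h₄ C halt hl hdiv s₁ s₂ s₃
      (fun t => by obtain ⟨P, b₁, b₂, b₃, -, h⟩ := hgenK t; exact ⟨P, b₁, b₂, b₃, h⟩)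
  · exact exists_odd_point_kummer_eq_adjugate_of_selmerFour hsq hr h₂ h₄ C halt hl hT hdiv s₁ s₂ s₃ _ rfl hgenK
  · exact kummer_eq_or_eq_add_adjugate_of_selmerFour hsq hr h₂ h₄ C halt hl hT hdiv s₁ s₂ s₃ _ rfl hgenK

end JumpOne

end Summit.BirchSwinnertonDyer.PrintCf2.AdjugatePin

end
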